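import Summits.CriticalPhenomena.PercolationContinuityZ3.Theorems.PercNearOneGluingNoHeavyLowerTailCSHPeel
import Summits.CriticalPhenomena.PercolationContinuityZ3.Theorems.PercNearOneGluingNoHeavyLowerTailQuantitativeLemmaAC
import Summits.CriticalPhenomena.PercolationContinuityZ3.Theorems.PercNearOneGluingNoHeavyLowerTailCSHTheoremOne
import HarnessLib

/-!
# Quantitative (S5D)/(S5) surplus transfer in the Sur-form: the RANK GAINS survive the peeling
# (`s5dMargin ≥ Σ_{a ∈ T} γ_a · μ(o ∈ C_a | a ↮ (T∖a) ∪ D ∪ {v})`)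

Support file (`--supports stmt-CriticalPhenomena-4575`), prover seat `prim-rate-mine-2` (lane prim-rate, constants-miner (c), BENCH row
M2-R3).  One definition (`CSH.rankGain`), no named facts, no sorries; standard axioms.

prim-hp-8's peeling induction `CSH.s5dMargin_nonneg_of_csh` (paper §4.2, Theorem 4.2) proves `s5dMargin w T r D o v F ≥ 0` from the conditioned
slack hierarchy by peeling the rank-maximal relay `k` and DISCARDING two nonnegative terms: the slack `γ_k := Sur_k(T') − κ_k` of Lemma κ
(`CSH.kappa_le_surplus`) times `Marg[c_k]`, and the CSH term of the peeled relay.  THIS FILE keeps the first one and bounds `Marg[c_k]` from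
below by the quantitative Lemma AC (`CSH.avoidConst_le_cshMarg`, `≥ μ(o ∈ C_k | k ↮ T' ∪ D ∪ {v})`):

* `CSH.rankGain w T r F a = Σ_{a' ∈ T, r a' < r a} μ(P^a_{a'}) · (m_a − m_{a'})` — the RANK GAIN of the relay `a` over the lower relays
  (`P^a_{a'}` = "`a'` is the first lower relay in `C_a`"; `= Sur_a(T_{<a}) − Cov(F(C_a), 1{a ↔ T_{<a}}) ≥ 0`, `rankGain_nonneg`);
* **`CSH.s5dMargin_ge_sum_rankGain_of_csh`**: under the hypotheses of `s5dMargin_nonneg_of_csh` (non-degenerate weights, CSH for every owner /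
  avoided set / decoy list, monotone `F`, injective compatible rank, observers and decoys off `T`),
  `Σ_{a ∈ T} rankGain w T r F a · avoidConst w a (↑(T∖a) ∪ D ∪ {v}) o ≤ s5dMargin w T r D o v F`;
* **`CSH.surplusTransfer_ge_sum_rankGain_of_csh`** (`D = []`, the (S5) shape):
  `μ(v↮T)·Σ_a γ_a q_a + μ(v↮T, o↔v)·Sur_v(T) ≤ μ(v↮T)·Sur_o(T)`;
* **`CSH.s5dMargin_ge_sum_rankGain`, `CSH.surplusTransfer_ge_sum_rankGain`**: the same UNCONDITIONALLY for `o ≠ v` (the hierarchy is the tree's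
  theorem `CSH.cshAll`).
The constant `1` is sharp (lane census: equality instances on 4- and 5-vertex graphs; exact, 0 violations in 89 892 instances n ≤ 5, mine-ref
held-out 6 454 checks); the pre-FKG analogue with `(m_a − m_c)` in place of `γ_a` is `PreFKGSurplus.preMargin_ge_sum_of_csh`, and for `Sur` that
shape is FALSE (lane census: 1 794 / 6 300 exact violations at n = 5) — the rank gain is the right coefficient.
[cite: KozmaNitzan2024, Conj. 4 (p. 32), Lemma 2 (p. 6)] [cite: VandenbergHaggstromKahn2005, Thm. 1.3 (p. 6)]
-/

noncomputable section

namespace Summit.CriticalPhenomena.PercolationContinuityZ3.Theorems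

open MeasureTheory Set Literature.Probability.LatticeModels Literature.Probability.Percolation
open scoped Classical
open KNPreFKG

namespace CSH

variable {V : Type*}

/-- **The rank gain `γ_a` of a relay** over the lower-ranked relays of `T`:
`γ_a = Σ_{a' ∈ T, r a' < r a} μ({a ↔ a'} ∩ ⋂_{r a'' < r a'} {a ↮ a''}) · (m_a − m_{a'})`, `m = ∫ F(C ·)`.  [this file] -/
def rankGain (w : Sym2 V → unitInterval) (T : Finset V) (r : V → ℕ) (F : Set V → ℝ) (a : V) : ℝ :=
  ∑ a' ∈ T.filter (fun a' => r a' < r a),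
    (prodBernoulli w).real
        (openConn a a' ∩ ⋂ a'' ∈ (T.filter (fun a' => r a' < r a)).filter (fun a'' => r a'' < r a'),
          (openConn a a'')ᶜ : Set (BondConfig V)) *
      ((∫ ω, F (openCluster ω a) ∂(prodBernoulli w)) - ∫ ω, F (openCluster ω a') ∂(prodBernoulli w))

variable {n : ℕ}

/-- The rank gain is nonnegative for a compatible rank. [this file] -/
theorem rankGain_nonneg (w : Sym2 (Fin n) → unitInterval) (T : Finset (Fin n)) (r : Fin n → ℕ) (F : Set (Fin n) → ℝ) (a : Fin n)
    (hcompat : ∀ a' ∈ T, r a' < r a →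
      ∫ ω, F (openCluster ω a') ∂(prodBernoulli w) ≤ ∫ ω, F (openCluster ω a) ∂(prodBernoulli w)) :
    0 ≤ rankGain w T r F a := by
  unfold rankGain
  refine Finset.sum_nonneg fun a' ha' => mul_nonneg measureReal_nonneg ?_
  have := hcompat a' (Finset.mem_filter.1 ha').1 (Finset.mem_filter.1 ha').2
  linarith

/-- For the rank-maximal relay `k` of `T` (lower set `T' = T.erase k`), the rank gain is the slack of Lemma κ:
`γ_k = Sur_k(T') − κ_k`, `κ_k = m_k μ(k ↮ T') − ∫_{k↮T'} F(C_k)`. [this file] -/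
theorem rankGain_top_eq (w : Sym2 (Fin n) → unitInterval) (T : Finset (Fin n)) (r : Fin n → ℕ) (F : Set (Fin n) → ℝ) (k : Fin n)
    (hkT : k ∈ T) (hr : Set.InjOn r ↑T) (hkmax : ∀ a ∈ T, r a ≤ r k) :
    rankGain w T r F k =
      surplus w (T.erase k) r F k -
        ((∫ ω, F (openCluster ω k) ∂(prodBernoulli w)) *
            (prodBernoulli w).real {ω : BondConfig (Fin n) | ∀ a ∈ (↑(T.erase k) : Set (Fin n)), ¬ (openGraph ω).Reachable k a} -
          ∫ ω in {ω : BondConfig (Fin n) | ∀ a ∈ (↑(T.erase k) : Set (Fin n)), ¬ (openGraph ω).Reachable k a},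
            F (openCluster ω k) ∂(prodBernoulli w)) := by
  classical
  have hmeas : ∀ S : Set (BondConfig (Fin n)), MeasurableSet S := fun _ => MeasurableSet.of_discrete
  set T' : Finset (Fin n) := T.erase k with hT'
  -- the lower set of `k` is `T' = T.erase k`
  have hfilt : T.filter (fun a' => r a' < r k) = T' := by
    ext a
    simp only [Finset.mem_filter, hT', Finset.mem_erase]
    constructor
    · rintro ⟨ha, hlt⟩
      exact ⟨fun h => (lt_irrefl _) (h ▸ hlt), ha⟩
    · rintro ⟨hak, ha⟩
      exact ⟨ha, lt_of_le_of_ne (hkmax a ha) (fun h => hak (hr ha hkT h))⟩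
  have hrT' : Set.InjOn r ↑T' := hr.mono (by intro a ha; exact Finset.mem_of_mem_erase ha)
  -- complement / partition identities
  set Dk : Set (BondConfig (Fin n)) := {ω : BondConfig (Fin n) | ∀ a ∈ (↑T' : Set (Fin n)), ¬ (openGraph ω).Reachable k a} with hDk
  set Wk : Set (BondConfig (Fin n)) := ⋃ a ∈ T', openConn k a with hWk
  have hDW : Dk = Wkᶜ := by
    ext ω
    simp [hDk, hWk, openConn]
  have hDint : ∫ ω in Dk, F (openCluster ω k) ∂(prodBernoulli w)
      = (∫ ω, F (openCluster ω k) ∂(prodBernoulli w)) - ∫ ω in Wk, F (openCluster ω k) ∂(prodBernoulli w) := by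
    have := integral_add_compl (μ := prodBernoulli w) (hmeas Wk) (Integrable.of_finite (f := fun ω => F (openCluster ω k)))
    rw [← hDW] at this
    linarith
  have hDμ : (prodBernoulli w).real Dk = 1 - (prodBernoulli w).real Wk := by
    have h1 : (prodBernoulli w).real (univ : Set (BondConfig (Fin n)))
        = (prodBernoulli w).real (univ ∩ Wk) + (prodBernoulli w).real (univ \ Wk) :=
      (measureReal_inter_add_sdiff (s := univ) (h := measure_ne_top _ _) (hmeas Wk)).symm
    rw [probReal_univ, univ_inter, ← compl_eq_univ_sdiff, ← hDW] at h1
    linarith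
  have hWsum : ∑ a ∈ T', (prodBernoulli w).real (openConn k a ∩ ⋂ a' ∈ T'.filter (fun a' => r a' < r a), (openConn k a')ᶜ : Set (BondConfig (Fin n)))
      = (prodBernoulli w).real Wk := AGloc.sum_measureReal_firstRank w T' r k hrT'
  unfold rankGain surplus
  rw [hfilt, hDint, hDμ, Finset.sum_congr rfl (fun a _ => mul_sub _ _ _), Finset.sum_sub_distrib, ← Finset.sum_mul, hWsum]
  ring

/-- Removing the rank-maximal relay does not change the rank gains of the other relays. [this file] -/
theorem rankGain_erase_top (w : Sym2 (Fin n) → unitInterval) (T : Finset (Fin n)) (r : Fin n → ℕ) (F : Set (Fin n) → ℝ)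
    (k a : Fin n) (ha : a ∈ T.erase k) (hkmax : ∀ a ∈ T, r a ≤ r k) (hr : Set.InjOn r ↑T) (hkT : k ∈ T) :
    rankGain w (T.erase k) r F a = rankGain w T r F a := by
  have hlt : r a < r k :=
    lt_of_le_of_ne (hkmax a (Finset.mem_of_mem_erase ha)) (fun h => (Finset.ne_of_mem_erase ha) (hr (Finset.mem_of_mem_erase ha) hkT h))
  have hfilt : (T.erase k).filter (fun a' => r a' < r a) = T.filter (fun a' => r a' < r a) := by
    ext a'
    simp only [Finset.mem_filter, Finset.mem_erase]
    constructor
    · rintro ⟨⟨_, h1⟩, h2⟩; exact ⟨h1, h2⟩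
    · rintro ⟨h1, h2⟩
      exact ⟨⟨fun h => (lt_irrefl (r k)) (lt_trans (h ▸ h2) hlt), h1⟩, h2⟩
  unfold rankGain
  rw [hfilt]

/-- **Quantitative (S5D): the rank gains survive the peeling.**  Under the hypotheses of `s5dMargin_nonneg_of_csh`:
`Σ_{a ∈ T} rankGain w T r F a · μ(o ∈ C_a | a ↮ (T∖a) ∪ D ∪ {v}) ≤ s5dMargin w T r D o v F`.
(prim-hp-8's induction with Lemma κ's slack kept and `Marg[c_k] ≥ μ(o∈C_k | k ↮ T' ∪ D ∪ {v})` from the quantitative Lemma AC.)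
[cite: KozmaNitzan2024, Conj. 4 (p. 32), Lemma 2 (p. 6)] -/
theorem s5dMargin_ge_sum_rankGain_of_csh (w : Sym2 (Fin n) → unitInterval) (hw : ∀ e, 0 < w e ∧ w e < 1) (o v : Fin n)
    (hCSH : ∀ (x : Fin n) (Y : Finset (Fin n)) (D : List (Fin n)),
      x ∉ Y → o ≠ x → v ≠ x → o ∉ Y → v ∉ Y → D.Nodup → (∀ d ∈ D, d ≠ x ∧ d ∉ Y ∧ d ≠ o ∧ d ≠ v) →
      CSHHolds w x (↑Y : Set (Fin n)) D o v) :
    ∀ (T : Finset (Fin n)) (r : Fin n → ℕ) (D : List (Fin n)) (F : Set (Fin n) → ℝ),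
      (∀ S S' : Set (Fin n), S ⊆ S' → F S ≤ F S') → Set.InjOn r ↑T →
      (∀ a ∈ T, ∀ a' ∈ T, r a < r a' →
        ∫ ω, F (openCluster ω a) ∂(prodBernoulli w) ≤ ∫ ω, F (openCluster ω a') ∂(prodBernoulli w)) →
      o ∉ T → v ∉ T → D.Nodup → (∀ d ∈ D, d ∉ T ∧ d ≠ o ∧ d ≠ v) →
      ∑ a ∈ T, rankGain w T r F a * avoidConst w a ((↑(T.erase a) : Set (Fin n)) ∪ ({d | d ∈ D} ∪ {v})) o
        ≤ s5dMargin w T r D o v F := by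
  classical
  -- strong induction on `|T|`
  have main : ∀ (N : ℕ) (T : Finset (Fin n)) (r : Fin n → ℕ) (D : List (Fin n)) (F : Set (Fin n) → ℝ), T.card = N →
      (∀ S S' : Set (Fin n), S ⊆ S' → F S ≤ F S') → Set.InjOn r ↑T →
      (∀ a ∈ T, ∀ a' ∈ T, r a < r a' →
        ∫ ω, F (openCluster ω a) ∂(prodBernoulli w) ≤ ∫ ω, F (openCluster ω a') ∂(prodBernoulli w)) →
      o ∉ T → v ∉ T → D.Nodup → (∀ d ∈ D, d ∉ T ∧ d ≠ o ∧ d ≠ v) →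
      ∑ a ∈ T, rankGain w T r F a * avoidConst w a ((↑(T.erase a) : Set (Fin n)) ∪ ({d | d ∈ D} ∪ {v})) o
        ≤ s5dMargin w T r D o v F := by
    intro N
    induction N using Nat.strong_induction_on with
    | _ N ih =>
    intro T r D F hN hF hr hcompat hoT hvT hD hDT
    set μ := prodBernoulli w with hμ
    have hmeas : ∀ S : Set (BondConfig (Fin n)), MeasurableSet S := fun _ => MeasurableSet.of_discrete
    have hn := fun (S : Set (BondConfig (Fin n))) => (measureReal_nonneg : 0 ≤ μ.real S)
    rcases T.eq_empty_or_nonempty with hT0 | hne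
    · -- no relays: both sides vanish
      subst hT0
      have h0 : surplus w (∅ : Finset (Fin n)) r F = fun _ => 0 := by
        funext u; simp [surplus]
      rw [Finset.sum_empty, s5dMargin, h0]
      have := slForm_zero (decoyList w (↑(∅ : Finset (Fin n)) : Set (Fin n)) D)
      simp only [cshMarg]
      rw [show (fun _ : Fin n => (0 : ℝ)) = (0 : Fin n → ℝ) from rfl, this]
      simp
    -- the rank-maximal relay `k` and `T' = T.erase k`
    obtain ⟨k, hkT, hkmax⟩ := Finset.exists_max_image T r hne
    set T' : Finset (Fin n) := T.erase k with hT'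
    have hTcard : T'.card < N := by
      have hpos : 0 < T.card := Finset.card_pos.2 hne
      rw [hT', Finset.card_erase_of_mem hkT]; omega
    have hT'T : ∀ a ∈ T', a ∈ T := fun a ha => Finset.mem_of_mem_erase ha
    have hkT' : k ∉ T' := Finset.notMem_erase k T
    have hlt : ∀ a ∈ T', r a < r k := by
      intro a ha
      rcases (hkmax a (hT'T a ha)).lt_or_eq with h | h
      · exact h
      · exact absurd (hr (hT'T a ha) hkT h) (Finset.ne_of_mem_erase ha)
    have hrT' : Set.InjOn r ↑T' := hr.mono (by intro a ha; exact hT'T a ha)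
    have hcompatT' : ∀ a ∈ T', ∀ a' ∈ T', r a < r a' →
        ∫ ω, F (openCluster ω a) ∂μ ≤ ∫ ω, F (openCluster ω a') ∂μ :=
      fun a ha a' ha' h => hcompat a (hT'T a ha) a' (hT'T a' ha') h
    have hmle : ∀ a ∈ T', ∫ ω, F (openCluster ω a) ∂μ ≤ ∫ ω, F (openCluster ω k) ∂μ :=
      fun a ha => hcompat a (hT'T a ha) k hkT (hlt a ha)
    have hko : o ≠ k := fun h => hoT (h ▸ hkT)
    have hkv : v ≠ k := fun h => hvT (h ▸ hkT)
    have hkD : k ∉ D := fun h => (hDT k h).1 hkT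
    -- the objects
    set Dk : Set (BondConfig (Fin n)) := {ω : BondConfig (Fin n) | ∀ a ∈ (↑T' : Set (Fin n)), ¬ (openGraph ω).Reachable k a}
      with hDk
    set mk : ℝ := ∫ ω, F (openCluster ω k) ∂μ with hmk
    set κ : ℝ := mk * μ.real Dk - ∫ ω in Dk, F (openCluster ω k) ∂μ with hκ
    set L := decoyList w (↑T : Set (Fin n)) D with hL
    set p : ℝ := obsConst w o v ((↑T : Set (Fin n)) ∪ {d | d ∈ D}) with hp
    set ck : Fin n → ℝ := avoidConst w k (↑T' : Set (Fin n)) with hck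
    set Fh : Set (Sym2 (Fin n)) → ℝ := fun C => F {a | a = k ∨ ∃ e ∈ C, a ∈ e} with hFh
    set Tk : Fin n → ℝ := fun u => (∫ ω in Dk ∩ openConn k u, F (openCluster ω k) ∂μ) - μ.real (Dk ∩ openConn k u) * mk
      with hTk
    set qk : ℝ := avoidConst w k ((↑T' : Set (Fin n)) ∪ ({d | d ∈ D} ∪ {v})) o with hqk
    -- positivity of the conditioning events (non-degenerate weights)
    have hempty_Dk : (∅ : BondConfig (Fin n)) ∈ Dk := by
      intro a ha h
      rw [HullPort.reachable_empty_iff] at h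
      exact hkT' (h ▸ (Finset.mem_coe.1 ha))
    have hDkpos : 0 < μ.real Dk := prodBernoulli_real_pos_of_nonempty hw ⟨∅, hempty_Dk⟩
    -- set identities between the systems `(T; D)`, `(T'; k; D)` and `(T'; k :: D)`
    have hins : insert k (↑T' : Set (Fin n)) = ↑T := by
      rw [hT', Finset.coe_erase, insert_sdiff_singleton, insert_eq_of_mem (Finset.mem_coe.2 hkT)]
    have hset2 : (↑T' : Set (Fin n)) ∪ {d | d ∈ k :: D} = (↑T : Set (Fin n)) ∪ {d | d ∈ D} := by
      ext a
      simp only [mem_union, Finset.mem_coe, hT', Finset.mem_erase, mem_setOf_eq, List.mem_cons]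
      constructor
      · rintro (⟨_, ha⟩ | rfl | ha)
        · exact Or.inl ha
        · exact Or.inl hkT
        · exact Or.inr ha
      · rintro (ha | ha)
        · by_cases hak : a = k
          · exact Or.inr (Or.inl hak)
          · exact Or.inl ⟨hak, ha⟩
        · exact Or.inr (Or.inr ha)
    have hcshMargin : ∀ f : Set (Sym2 (Fin n)) → ℝ,
        cshMargin w k (↑T' : Set (Fin n)) D o v f = cshMarg L p o v (covD w k (↑T' : Set (Fin n)) f) := by
      intro f
      rw [cshMargin, hins]
    have hnext : s5dMargin w T' r (k :: D) o v F =
        cshMarg L p o v (surplus w T' r F) - surplus w T' r F k * cshMarg L p o v ck := by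
      rw [s5dMargin, hset2, decoyList, hins, cshMarg_cons]
    -- (1) Lemma P: peel `k`
    have hpeel : surplus w T r F = (surplus w T' r F) + Tk := by
      funext u
      rw [Pi.add_apply, surplus_erase_add w T r F hkT hlt u]
    -- (2) the top-relay term through `covD`
    have hTk_cov : (μ.real Dk) • Tk = covD w k (↑T' : Set (Fin n)) Fh - (κ * μ.real Dk) • ck := by
      funext u
      simp only [Pi.smul_apply, Pi.sub_apply, smul_eq_mul]
      have h1 := covD_clusterFun_eq w T' F k u
      have h2 : μ.real (Dk ∩ openConn k u) = μ.real Dk * ck u := by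
        simp only [hck, avoidConst, hDk]
        rw [mul_div_cancel₀ _ (ne_of_gt hDkpos)]
      simp only [hTk, hFh, hκ, hmk, hDk] at h1 h2 ⊢
      rw [h1, h2]
      ring
    -- (3) CSH for the peeled relay, functional `F̂`
    have hCSHk := hCSH k T' D hkT' hko hkv (fun h => hoT (hT'T o h)) (fun h => hvT (hT'T v h)) hD
      (fun d hd => ⟨fun h => hkD (h ▸ hd), fun h => (hDT d hd).1 (hT'T d h), (hDT d hd).2.1, (hDT d hd).2.2⟩)
    have h3 : 0 ≤ cshMarg L p o v (covD w k (↑T' : Set (Fin n)) Fh) := by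
      rw [← hcshMargin]
      exact hCSHk Fh (monotone_clusterFun k F hF)
    -- (4) QUANTITATIVE Lemma AC: `Marg[c_k] ≥ q_k`
    have h4 : qk ≤ cshMarg L p o v ck := by
      have h := avoidConst_le_cshMarg w hw k (↑T' : Set (Fin n)) D o v (fun h => hkT' (Finset.mem_coe.1 h)) hkD hkv.symm hCSHk
      rw [hins] at h
      simpa only [hqk, hck, hL, hp] using h
    -- (5) Lemma κ with its slack: `Sur_k(T') − κ = γ_k ≥ 0`
    have h5 : surplus w T' r F k - κ = rankGain w T r F k := by
      rw [rankGain_top_eq w T r F k hkT hr hkmax]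
    have hγk : 0 ≤ rankGain w T r F k :=
      rankGain_nonneg w T r F k (fun a' ha' hlt' => hcompat a' ha' k hkT hlt')
    -- (6) the next rung by induction (WITH its gains)
    have h6 : ∑ a ∈ T', rankGain w T' r F a * avoidConst w a ((↑(T'.erase a) : Set (Fin n)) ∪ ({d | d ∈ k :: D} ∪ {v})) o
        ≤ s5dMargin w T' r (k :: D) o v F :=
      ih T'.card hTcard T' r (k :: D) F rfl hF hrT' hcompatT' (fun h => hoT (hT'T o h)) (fun h => hvT (hT'T v h))
        (List.nodup_cons.2 ⟨hkD, hD⟩)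
        (fun d hd => by
          rcases List.mem_cons.1 hd with rfl | hd
          · exact ⟨hkT', hko.symm, hkv.symm⟩
          · exact ⟨fun h => (hDT d hd).1 (hT'T d h), (hDT d hd).2.1, (hDT d hd).2.2⟩)
    -- (6b) the induction sum is the `T'`-part of the target sum
    have hsumT' : ∑ a ∈ T', rankGain w T' r F a * avoidConst w a ((↑(T'.erase a) : Set (Fin n)) ∪ ({d | d ∈ k :: D} ∪ {v})) o
        = ∑ a ∈ T', rankGain w T r F a * avoidConst w a ((↑(T.erase a) : Set (Fin n)) ∪ ({d | d ∈ D} ∪ {v})) o := by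
      refine Finset.sum_congr rfl fun a ha => ?_
      have hak : a ≠ k := Finset.ne_of_mem_erase ha
      have hset : (↑(T'.erase a) : Set (Fin n)) ∪ ({d | d ∈ k :: D} ∪ {v}) = (↑(T.erase a) : Set (Fin n)) ∪ ({d | d ∈ D} ∪ {v}) := by
        ext b
        simp only [mem_union, Finset.mem_coe, hT', Finset.mem_erase, mem_setOf_eq, List.mem_cons, mem_singleton_iff]
        constructor
        · rintro (⟨hba, _, hbT⟩ | (rfl | hbD) | hbv)
          · exact Or.inl ⟨hba, hbT⟩
          · exact Or.inl ⟨hak.symm, hkT⟩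
          · exact Or.inr (Or.inl hbD)
          · exact Or.inr (Or.inr hbv)
        · rintro (⟨hba, hbT⟩ | hbD | hbv)
          · by_cases hbk : b = k
            · exact Or.inr (Or.inl (Or.inl hbk))
            · exact Or.inl ⟨hba, hbk, hbT⟩
          · exact Or.inr (Or.inl (Or.inr hbD))
          · exact Or.inr (Or.inr hbv)
      rw [rankGain_erase_top w T r F k a ha hkmax hr hkT, hset]
    -- (6c) the `k`-term of the target sum
    have hqk' : avoidConst w k ((↑(T.erase k) : Set (Fin n)) ∪ ({d | d ∈ D} ∪ {v})) o = qk := by rfl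
    -- (7) assemble: `μ(Dk)·M(T;D) = μ(Dk)·M(T';k::D) + CSH-term + γ_k·μ(Dk)·Marg[c_k]`
    have hmain : μ.real Dk * s5dMargin w T r D o v F =
        μ.real Dk * cshMarg L p o v (surplus w T' r F) + cshMarg L p o v (covD w k (↑T' : Set (Fin n)) Fh) -
          κ * μ.real Dk * cshMarg L p o v ck := by
      have e1 : μ.real Dk * cshMarg L p o v Tk =
          cshMarg L p o v (covD w k (↑T' : Set (Fin n)) Fh) - κ * μ.real Dk * cshMarg L p o v ck := by
        rw [← cshMarg_smul, hTk_cov, cshMarg_sub, cshMarg_smul]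
      rw [s5dMargin, ← hL, ← hp, hpeel, cshMarg_add, mul_add, e1]
      ring
    have hkey : μ.real Dk * s5dMargin w T r D o v F =
        μ.real Dk * s5dMargin w T' r (k :: D) o v F + cshMarg L p o v (covD w k (↑T' : Set (Fin n)) Fh) +
          rankGain w T r F k * μ.real Dk * cshMarg L p o v ck := by
      rw [hmain, hnext, ← h5]
      ring
    have hgain : rankGain w T r F k * μ.real Dk * qk ≤ rankGain w T r F k * μ.real Dk * cshMarg L p o v ck :=
      mul_le_mul_of_nonneg_left h4 (mul_nonneg hγk hDkpos.le)
    have hbound : μ.real Dk * (∑ a ∈ T, rankGain w T r F a * avoidConst w a ((↑(T.erase a) : Set (Fin n)) ∪ ({d | d ∈ D} ∪ {v})) o)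
        ≤ μ.real Dk * s5dMargin w T r D o v F := by
      rw [← Finset.add_sum_erase T _ hkT, ← hT', ← hsumT', hqk', mul_add, hkey]
      have := mul_le_mul_of_nonneg_left h6 hDkpos.le
      nlinarith [h3, hgain, this, hDkpos.le]
    exact le_of_mul_le_mul_left hbound hDkpos
  intro T r D F hF hr hcompat hoT hvT hD hDT
  exact main T.card T r D F rfl hF hr hcompat hoT hvT hD hDT

/-- **Quantitative (S5), the `hS5` shape** (`D = []`): under the hypotheses of `s5dMargin_nonneg_of_csh`,
`μ(v↮T)·Σ_{a∈T} γ_a·μ(o∈C_a | a ↮ (T∖a) ∪ {v}) + μ(v↮T, o↔v)·Sur_v(T) ≤ μ(v↮T)·Sur_o(T)`.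
[cite: KozmaNitzan2024, Conj. 4 (p. 32)] -/
theorem surplusTransfer_ge_sum_rankGain_of_csh (w : Sym2 (Fin n) → unitInterval) (hw : ∀ e, 0 < w e ∧ w e < 1) (o v : Fin n)
    (hCSH : ∀ (x : Fin n) (Y : Finset (Fin n)) (D : List (Fin n)),
      x ∉ Y → o ≠ x → v ≠ x → o ∉ Y → v ∉ Y → D.Nodup → (∀ d ∈ D, d ≠ x ∧ d ∉ Y ∧ d ≠ o ∧ d ≠ v) →
      CSHHolds w x (↑Y : Set (Fin n)) D o v)
    (T : Finset (Fin n)) (r : Fin n → ℕ) (F : Set (Fin n) → ℝ)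
    (hF : ∀ S S' : Set (Fin n), S ⊆ S' → F S ≤ F S') (hr : Set.InjOn r ↑T)
    (hcompat : ∀ a ∈ T, ∀ a' ∈ T, r a < r a' →
      ∫ ω, F (openCluster ω a) ∂(prodBernoulli w) ≤ ∫ ω, F (openCluster ω a') ∂(prodBernoulli w))
    (hoT : o ∉ T) (hvT : v ∉ T) :
    (prodBernoulli w).real {ω : BondConfig (Fin n) | ∀ a ∈ (↑T : Set (Fin n)), ¬ (openGraph ω).Reachable v a} *
          (∑ a ∈ T, rankGain w T r F a * avoidConst w a ((↑(T.erase a) : Set (Fin n)) ∪ {v}) o) +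
        (prodBernoulli w).real ({ω : BondConfig (Fin n) | ∀ a ∈ (↑T : Set (Fin n)), ¬ (openGraph ω).Reachable v a} ∩ openConn o v) *
          surplus w T r F v ≤
      (prodBernoulli w).real {ω : BondConfig (Fin n) | ∀ a ∈ (↑T : Set (Fin n)), ¬ (openGraph ω).Reachable v a} * surplus w T r F o := by
  classical
  have h := s5dMargin_ge_sum_rankGain_of_csh w hw o v hCSH T r [] F hF hr hcompat hoT hvT List.nodup_nil (fun d hd => by simp at hd)
  have hnil : ∀ a : Fin n, ((↑(T.erase a) : Set (Fin n)) ∪ ({d | d ∈ ([] : List (Fin n))} ∪ {v})) = (↑(T.erase a) : Set (Fin n)) ∪ {v} := by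
    intro a; simp
  simp only [hnil] at h
  rw [s5dMargin_nil] at h
  set M := (prodBernoulli w).real {ω : BondConfig (Fin n) | ∀ a ∈ (↑T : Set (Fin n)), ¬ (openGraph ω).Reachable v a} with hM
  set E := (prodBernoulli w).real ({ω : BondConfig (Fin n) | ∀ a ∈ (↑T : Set (Fin n)), ¬ (openGraph ω).Reachable v a} ∩ openConn o v)
    with hE
  have hempty : (∅ : BondConfig (Fin n)) ∈ {ω : BondConfig (Fin n) | ∀ a ∈ (↑T : Set (Fin n)), ¬ (openGraph ω).Reachable v a} := by
    intro a ha hva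
    rw [HullPort.reachable_empty_iff] at hva
    exact hvT (hva ▸ (Finset.mem_coe.1 ha))
  have hMpos : 0 < M := prodBernoulli_real_pos_of_nonempty hw ⟨∅, hempty⟩
  have h2 := mul_le_mul_of_nonneg_left h hMpos.le
  have h3 : M * (surplus w T r F o - E / M * surplus w T r F v) = M * surplus w T r F o - E * surplus w T r F v := by
    field_simp
  linarith [h2, h3]

/-- **Quantitative (S5D), unconditional** (the hierarchy is the tree theorem `CSH.cshAll`): for non-degenerate weights, `o ≠ v`, monotone `F`,
an injective compatible rank, observers and decoys off `T`:
`Σ_{a ∈ T} rankGain w T r F a · μ(o ∈ C_a | a ↮ (T∖a) ∪ D ∪ {v}) ≤ s5dMargin w T r D o v F`. [cite: KozmaNitzan2024, Conj. 4 (p. 32)] -/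
theorem s5dMargin_ge_sum_rankGain (w : Sym2 (Fin n) → unitInterval) (hw : ∀ e, 0 < w e ∧ w e < 1) (o v : Fin n) (hov : o ≠ v)
    (T : Finset (Fin n)) (r : Fin n → ℕ) (D : List (Fin n)) (F : Set (Fin n) → ℝ)
    (hF : ∀ S S' : Set (Fin n), S ⊆ S' → F S ≤ F S') (hr : Set.InjOn r ↑T)
    (hcompat : ∀ a ∈ T, ∀ a' ∈ T, r a < r a' →
      ∫ ω, F (openCluster ω a) ∂(prodBernoulli w) ≤ ∫ ω, F (openCluster ω a') ∂(prodBernoulli w))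
    (hoT : o ∉ T) (hvT : v ∉ T) (hD : D.Nodup) (hDT : ∀ d ∈ D, d ∉ T ∧ d ≠ o ∧ d ≠ v) :
    ∑ a ∈ T, rankGain w T r F a * avoidConst w a ((↑(T.erase a) : Set (Fin n)) ∪ ({d | d ∈ D} ∪ {v})) o
      ≤ s5dMargin w T r D o v F :=
  s5dMargin_ge_sum_rankGain_of_csh w hw o v (fun x Y D' hxY hox hvx hoY hvY hD' hdis => cshAll n w hw o v x Y D' hov hxY hox hvx hoY hvY hD' hdis)
    T r D F hF hr hcompat hoT hvT hD hDT

/-- **Quantitative (S5), unconditional `hS5` shape**: for non-degenerate weights and `o ≠ v` off `T`,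
`μ(v↮T)·Σ_{a∈T} γ_a·μ(o∈C_a | a ↮ (T∖a) ∪ {v}) + μ(v↮T, o↔v)·Sur_v(T) ≤ μ(v↮T)·Sur_o(T)`. [cite: KozmaNitzan2024, Conj. 4 (p. 32)] -/
theorem surplusTransfer_ge_sum_rankGain (w : Sym2 (Fin n) → unitInterval) (hw : ∀ e, 0 < w e ∧ w e < 1) (o v : Fin n) (hov : o ≠ v)
    (T : Finset (Fin n)) (r : Fin n → ℕ) (F : Set (Fin n) → ℝ)
    (hF : ∀ S S' : Set (Fin n), S ⊆ S' → F S ≤ F S') (hr : Set.InjOn r ↑T)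
    (hcompat : ∀ a ∈ T, ∀ a' ∈ T, r a < r a' →
      ∫ ω, F (openCluster ω a) ∂(prodBernoulli w) ≤ ∫ ω, F (openCluster ω a') ∂(prodBernoulli w))
    (hoT : o ∉ T) (hvT : v ∉ T) :
    (prodBernoulli w).real {ω : BondConfig (Fin n) | ∀ a ∈ (↑T : Set (Fin n)), ¬ (openGraph ω).Reachable v a} *
          (∑ a ∈ T, rankGain w T r F a * avoidConst w a ((↑(T.erase a) : Set (Fin n)) ∪ {v}) o) +
        (prodBernoulli w).real ({ω : BondConfig (Fin n) | ∀ a ∈ (↑T : Set (Fin n)), ¬ (openGraph ω).Reachable v a} ∩ openConn o v) *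
          surplus w T r F v ≤
      (prodBernoulli w).real {ω : BondConfig (Fin n) | ∀ a ∈ (↑T : Set (Fin n)), ¬ (openGraph ω).Reachable v a} * surplus w T r F o :=
  surplusTransfer_ge_sum_rankGain_of_csh w hw o v
    (fun x Y D' hxY hox hvx hoY hvY hD' hdis => cshAll n w hw o v x Y D' hov hxY hox hvx hoY hvY hD' hdis) T r F hF hr hcompat hoT hvT

end CSH

end Summit.CriticalPhenomena.PercolationContinuityZ3.Theorems
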